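import Summits.QuantumFields.YangMills.Theorems.PencilRigidityDiagonalMirrorRPRCentreReduction
import Summits.QuantumFields.YangMills.Theses.IsotropyFromPowerCounting

/-!
# Crux `DiagonalMirrorRPR` (stmt-QuantumFields-10604) is ELIMINABLE from the three routes that want it
# (crux-strategist r1, second opinion — supports the item, does not close it)

Routes `PencilRigidity`, `MirrorModularBoosts`, `IsotropyFromPowerCounting` of `YangMills` share the crux verbatim:
`D := ∀ G r sch S₁, W₁ r sch S₁ → DiagonalFrameRP S₁` — diagonal RP of EVERY gapped Wilson scaling limit of the curvature
channel along EVERY scheme (`β_k` of any sign and size, any `c_k, m_k, L_k`).  Twenty-eight line leads, five ideators, five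
triagers, three disprover cycles and two strategists found no proof strategy short of a finite-size transport theorem for 4D
Wilson theory at physical scale along an arbitrary gapped scheme (`Cruxes/DiagonalMirrorRPR/STRATEGY-CENSUS.md`).  This file is
the kernel-checked half of the second strategist's verdict **misstated by over-universality**:
* `closes_of_diagWitness` (`_mmb`): each route closes from its model-blind items and ONE weak-coupling witness of the existence
  leg whose OWN curvature channel is diagonally reflection positive — `D` is consumed POINTWISE, at the witness only;
* `slice_of_crux*`, `closes_of_slice*`, `closes_via_slice*`: a fortiori the routes' `closes` need only the WEAK-COUPLING SLICE
  `∀ …, W₁ → sch.HasWeakCouplingLimit → DiagonalFrameRP` (the Statement carries `sch.HasWeakCouplingLimit` since the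
  2026-08-16 re-type); what `D` says about bounded, negative, oscillating or fixed-intermediate couplings — where its difficulty
  is a fixed-coupling uniqueness / ultralocality problem of 4D lattice gauge theory the Statement never visits — is dead weight;
* `restatedCrux_v3_holds` / `restatedSlice_holds`: the slice with ONE more antecedent, convergence of the renormalised curvature
  strings to the same `S₁` along the Fröhlich–Israel–Lieb–Simon 45° covers (`tiltedLatticeSchwinger`, Literature p96664), is a
  THEOREM — the planners' restated crux v3 verbatim (`Cruxes/DiagonalMirrorRPR/RestateCheck.lean`, `Lines/restate-terms-c4.md`),
  closed by the landed `CentreTwistedSwap.Reduction.restatedCruxWeakCoupling_holds` (p117149);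
* `closes_restated*`: hence each route closes from its OTHER items once the existence leg carries that convergence clause (the
  leg's own statement with the cover clause conjoined right after `sch.HasWeakCouplingLimit`, spelled inline = the upstream
  threading of option A, `Lines/restate-terms-c4.md`), with the restated crux as a (closed) binder; `closes_without_diag*`: the
  same with no diagonal binder at all.
So the residue of `D` relative to every route that wants it is ONE convergence clause on ONE witness (a second boundaryless
volume shape for the existence leg), never a theorem about all schemes; the registered crux-level residual T⁺/T_c⁻/N⁻
(`Lines/centre_twisted_swap_residual.lean`) need not be proved by anyone.  Option B (split instead of restate):
`Cruxes/DiagonalMirrorRPR/PromoteCheck.lean`, `Lines/promote-terms-c6.md`.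
References: Fröhlich–Israel–Lieb–Simon, Comm. Math. Phys. 62 (1978) Thm 2.1; J. Stat. Phys. 22 (1980) §3 (45° boxes);
Osterwalder–Schrader, Comm. Math. Phys. 31 (1973); Osterwalder–Seiler, Ann. Phys. 110 (1978) §2; Jaffe–Witten (2000) §6, fn. 1.
-/

set_option autoImplicit false

noncomputable section

open scoped SchwartzMap
open MeasureTheory Filter Topology
open Literature.MathematicalPhysics.QuantumLattice Literature.MathematicalPhysics.AQFT
  Literature.MathematicalPhysics.QuantumFieldTheory

namespace Summit.QuantumFields.YangMills.Cruxes.DiagonalMirrorRPR.Eliminable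

open ParityBridgeColdTraces

/-! ## §1 The restated crux (v3) is a theorem (no new definitions in this file) -/

/-- **The planners' restated crux v3 holds** — the term of `Cruxes/DiagonalMirrorRPR/RestateCheck.lean` VERBATIM (route-file
binder shape, the Statement's `sch.HasWeakCouplingLimit` as sign clause, tilted-cover convergence as antecedent), i.e. exactly what a
`route edit --restate DiagonalMirrorRPR` would file; closed by the landed p117149, re-used by name. -/
theorem restatedCrux_v3_holds :
    open Literature.MathematicalPhysics.QuantumLattice Literature.MathematicalPhysics.AQFT Literature.MathematicalPhysics.QuantumFieldTheory in let E := EuclideanSpace ℝ (Fin 4); ∀ (G : Type) [Group G] [TopologicalSpace G] [IsTopologicalGroup G] [CompactSpace G], IsCompactSimpleLieGroup G → letI : MeasurableSpace G := borel G; haveI : BorelSpace G := ⟨rfl⟩; let W₁ := fun (r : LatticeRep G) (sch : SpeciesScheme (YMSpecies G)) (S₁ : SchwingerFamily E) => ((∀ (n : ℕ), n ≠ 0 → ∀ (f : Fin n → SchwartzMap (E) ℝ) (F : SchwartzMap (Fin n → E) ℂ), IsTensorOf F (fun i => ofRealTest (f i)) → IsOffDiagonal F → Filter.Tendsto (fun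 k : ℕ => ((latticeSchwinger r.ρ sch (fun s => s.F) k n (fun _ => r.curvature) f : ℝ) : ℂ)) Filter.atTop (nhds (S₁ n F))) ∧ (S₁.toLabelled.IsNormalized ∧ S₁.toLabelled.IsHermitian ∧ S₁.toLabelled.HasLinearGrowth ∧ S₁.toLabelled.IsReflectionPositive ∧ S₁.toLabelled.IsSymmetric ∧ S₁.toLabelled.HasClusterProperty) ∧ (∀ (n : ℕ) (a : E) (F : SchwartzMap (Fin n → E) ℂ), IsOffDiagonal F → S₁ n (translateMulti a F) = S₁ n F) ∧ (∀ (R : E ≃ₗᵢ[ℝ] E), LinearMap.det (R.toLinearEquiv : E →ₗ[ℝ] E) = 1 → (∀ i : Fin 4, ∃ j : Fin 4, R (EuclideanSpace.single i 1) = EuclideanSpace.single j 1 ∨ R (EuclideanSpace.single i 1) = -EuclideanSpace.single j 1) → ∀ (n : ℕ) (F : SchwartzMap (Fin n → E) ℂ), IsOffDiagonal F → S₁ n (linActMulti R F) = S₁ n F) ∧ (∃ Δ : ℝ, 0 < Δ ∧ S₁.toLabelled.HasMassGap Δ ∧ HasLatticeMassGap r sch Δ)); ∀ (r : LatticeRep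 G) (sch : SpeciesScheme (YMSpecies G)) (S₁ : SchwingerFamily E), W₁ r sch S₁ → sch.HasWeakCouplingLimit → (∀ (n : ℕ), n ≠ 0 → ∀ (f : Fin n → SchwartzMap (E) ℝ) (F : SchwartzMap (Fin n → E) ℂ), IsTensorOf F (fun i => ofRealTest (f i)) → IsOffDiagonal F → Filter.Tendsto (fun k : ℕ => ((tiltedLatticeSchwinger r.ρ sch (fun s => s.F) k n (fun _ => r.curvature) f : ℝ) : ℂ)) Filter.atTop (nhds (S₁ n F))) → ∀ (R : E ≃ₗᵢ[ℝ] E) (a b : ℝ), a ^ 2 = 1 / 2 → b ^ 2 = 1 / 2 → R (EuclideanSpace.single 0 1) = a • EuclideanSpace.single 0 1 + b • EuclideanSpace.single 1 1 → (SchwingerFamily.toLabelled (fun n => (S₁ n).comp (linActMulti R))).IsReflectionPositive :=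
  CentreTwistedSwap.Reduction.restatedCruxWeakCoupling_holds

/-- The same in the crux folder's short vocabulary (definitionally equal; the binder shape used below). -/
theorem restatedSlice_holds :
    (∀ (G : Type) [Group G] [TopologicalSpace G] [IsTopologicalGroup G] [CompactSpace G],
      IsCompactSimpleLieGroup G →
        letI : MeasurableSpace G := borel G
        haveI : BorelSpace G := ⟨rfl⟩
        ∀ (r : LatticeRep G) (sch : SpeciesScheme (YMSpecies G)) (S₁ : SchwingerFamily E4),
          CurvaturePackage r sch S₁ → sch.HasWeakCouplingLimit →
            (∀ (n : ℕ), n ≠ 0 → ∀ (f : Fin n → 𝓢(E4, ℝ)) (F : 𝓢((Fin n → E4), ℂ)),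
              IsTensorOf F (fun i => ofRealTest (f i)) → IsOffDiagonal F →
                Tendsto (fun k : ℕ =>
                  ((tiltedLatticeSchwinger r.ρ sch (fun s => s.F) k n (fun _ => r.curvature) f : ℝ) : ℂ))
                  atTop (𝓝 (S₁ n F))) →
              DiagonalFrameRP S₁) :=
  restatedCrux_v3_holds

/-! ## §2 Over-universality: the crux implies its weak-coupling slice (all three route copies) -/
/-- `PencilRigidity` copy ⇒ slice. -/
theorem slice_of_crux (h : Summit.QuantumFields.YangMills.Theses.PencilRigidity.DiagonalMirrorRPR) :
    (∀ (G : Type) [Group G] [TopologicalSpace G] [IsTopologicalGroup G] [CompactSpace G],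
        IsCompactSimpleLieGroup G →
          letI : MeasurableSpace G := borel G
          haveI : BorelSpace G := ⟨rfl⟩
          ∀ (r : LatticeRep G) (sch : SpeciesScheme (YMSpecies G)) (S₁ : SchwingerFamily E4),
            CurvaturePackage r sch S₁ → sch.HasWeakCouplingLimit → DiagonalFrameRP S₁) := by
  intro G _ _ _ _ hG
  letI : MeasurableSpace G := borel G
  haveI : BorelSpace G := ⟨rfl⟩
  exact fun r sch S₁ hW _ => h G hG r sch S₁ hW

/-- `MirrorModularBoosts` copy (the item's recorded decl) ⇒ slice. -/
theorem slice_of_crux_mmb (h : Summit.QuantumFields.YangMills.Theses.MirrorModularBoosts.DiagonalMirrorRPR) :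
    (∀ (G : Type) [Group G] [TopologicalSpace G] [IsTopologicalGroup G] [CompactSpace G],
        IsCompactSimpleLieGroup G →
          letI : MeasurableSpace G := borel G
          haveI : BorelSpace G := ⟨rfl⟩
          ∀ (r : LatticeRep G) (sch : SpeciesScheme (YMSpecies G)) (S₁ : SchwingerFamily E4),
            CurvaturePackage r sch S₁ → sch.HasWeakCouplingLimit → DiagonalFrameRP S₁) := by
  intro G _ _ _ _ hG
  letI : MeasurableSpace G := borel G
  haveI : BorelSpace G := ⟨rfl⟩
  exact fun r sch S₁ hW _ => h G hG r sch S₁ hW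

/-- `IsotropyFromPowerCounting` copy ⇒ slice. -/
theorem slice_of_crux_ifpc (h : Summit.QuantumFields.YangMills.Theses.IsotropyFromPowerCounting.DiagonalMirrorRPR) :
    (∀ (G : Type) [Group G] [TopologicalSpace G] [IsTopologicalGroup G] [CompactSpace G],
        IsCompactSimpleLieGroup G →
          letI : MeasurableSpace G := borel G
          haveI : BorelSpace G := ⟨rfl⟩
          ∀ (r : LatticeRep G) (sch : SpeciesScheme (YMSpecies G)) (S₁ : SchwingerFamily E4),
            CurvaturePackage r sch S₁ → sch.HasWeakCouplingLimit → DiagonalFrameRP S₁) := by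
  intro G _ _ _ _ hG
  letI : MeasurableSpace G := borel G
  haveI : BorelSpace G := ⟨rfl⟩
  exact fun r sch S₁ hW _ => h G hG r sch S₁ hW

/-! ## §3 Route `PencilRigidity` -/
section PencilRigidity

open Summit.QuantumFields.YangMills.Theses.PencilRigidity

/-- **`PencilRigidity` closes from ONE diagonally-RP weak-coupling witness** — the route's `closes` verbatim, the existence leg
(stmt-QuantumFields-16120) carrying ONE extra conjunct after `sch.HasWeakCouplingLimit`: diagonal-frame RP of its own channel. -/
theorem closes_of_diagWitness (hSR : ShellRigidity) (hNP : NPointIsotropy) (hKB : CurvatureKernelBound)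
    (hWit : open Literature.MathematicalPhysics.QuantumLattice Literature.MathematicalPhysics.AQFT Literature.MathematicalPhysics.QuantumFieldTheory in let E := EuclideanSpace ℝ (Fin 4); ∀ (G : Type) [Group G] [TopologicalSpace G] [IsTopologicalGroup G] [CompactSpace G], IsCompactSimpleLieGroup G → letI : MeasurableSpace G := borel G; haveI : BorelSpace G := ⟨rfl⟩; ∃ (r : LatticeRep G) (sch : SpeciesScheme (YMSpecies G)) (S : LabelledSchwingerFamily (YMSpecies G) (E)), sch.HasWeakCouplingLimit ∧ DiagonalFrameRP (fun n => S n (fun _ => r.curvature)) ∧ (∀ (n : ℕ) (k : Fin n → YMSpecies G), (∃ i, k i ≠ r.curvature) → ∀ F : SchwartzMap (Fin n → E) ℂ, S n k F = 0) ∧ (S.IsNormalized ∧ S.IsHermitian ∧ S.HasLinearGrowth ∧ S.IsReflectionPositive ∧ S.IsSymmetric ∧ S.HasClusterProperty ∧ (∀ (n : ℕ) (k : Fin n → YMSpecies G) (a : E) (F : SchwartzMap (Fin n → E) ℂ), IsOffDiagonal F → S n k (translateMulti a F) = S n k F) ∧ (∀ (n : ℕ) (k : Fin n → YMSpecies G)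 (R : E ≃ₗᵢ[ℝ] E), LinearMap.det (R.toLinearEquiv : E →ₗ[ℝ] E) = 1 → (∀ i : Fin 4, ∃ j : Fin 4, R (EuclideanSpace.single i 1) = EuclideanSpace.single j 1 ∨ R (EuclideanSpace.single i 1) = -EuclideanSpace.single j 1) → ∀ F : SchwartzMap (Fin n → E) ℂ, IsOffDiagonal F → S n k (linActMulti R F) = S n k F)) ∧ (∀ (n : ℕ), n ≠ 0 → ∀ (σ : Fin n → YMSpecies G) (f : Fin n → SchwartzMap (E) ℝ) (F : SchwartzMap (Fin n → E) ℂ), IsTensorOf F (fun i => ofRealTest (f i)) → IsOffDiagonal F → Filter.Tendsto (fun k : ℕ => ((latticeSchwinger r.ρ sch (fun s => s.F) k n σ f : ℝ) : ℂ)) Filter.atTop (nhds (S n σ F))) ∧ (∃ (F₁ G₁ : SchwartzMap (Fin 1 → E) ℂ) (H₁ : SchwartzMap (Fin (1 + 1) → E) ℂ), IsTimeOrdered F₁ ∧ IsTimeOrdered G₁ ∧ IsAppendTensorOf H₁ (osAdjoint F₁) G₁ ∧ S (1 + 1) (fun _ => r.curvature) H₁ ≠ S 1 (fun _ => r.curvature)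 (osAdjoint F₁) * S 1 (fun _ => r.curvature) G₁) ∧ (∃ (f g h : SchwartzMap (E) ℂ) (Ffgh : SchwartzMap (Fin 3 → E) ℂ) (Fgh Ffh Ffg : SchwartzMap (Fin 2 → E) ℂ) (Ff Fg Fh : SchwartzMap (Fin 1 → E) ℂ), IsTensorOf Ffgh ![f, g, h] ∧ IsOffDiagonal Ffgh ∧ IsTensorOf Fgh ![g, h] ∧ IsTensorOf Ffh ![f, h] ∧ IsTensorOf Ffg ![f, g] ∧ IsTensorOf Ff ![f] ∧ IsTensorOf Fg ![g] ∧ IsTensorOf Fh ![h] ∧ S 3 (fun _ => r.curvature) Ffgh - S 1 (fun _ => r.curvature) Ff * S 2 (fun _ => r.curvature) Fgh - S 1 (fun _ => r.curvature) Fg * S 2 (fun _ => r.curvature) Ffh - S 1 (fun _ => r.curvature) Fh * S 2 (fun _ => r.curvature) Ffg + 2 * (S 1 (fun _ => r.curvature) Ff * S 1 (fun _ => r.curvature) Fg * S 1 (fun _ => r.curvature) Fh) ≠ 0) ∧ (∃ Δ : ℝ, 0 < Δ ∧ S.HasMassGap Δ ∧ HasLatticeMassGap r sch Δ))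
    (hCC : CurvatureChannel) (hKT : KernelTransfer) (hPE : PlanarToEuclidean) : YangMills := by
  intro G i1 i2 i3 i4 hG
  letI : MeasurableSpace G := borel G
  haveI : BorelSpace G := ⟨rfl⟩
  obtain ⟨r, sch, S, hweak, hdiag, hzero, hW⟩ := hWit G hG
  obtain ⟨hW₁, hAxis⟩ := hCC G hG r sch S hW
  obtain ⟨hconv₁, hpkg₁, htr₁, hhyp₁, Δ₁, hΔ₁, hgap₁, hlat₁⟩ := hW₁
  have h8 : ∀ (R : EuclideanSpace ℝ (Fin 4) ≃ₗᵢ[ℝ] EuclideanSpace ℝ (Fin 4)) (a b : ℝ), a ^ 2 + b ^ 2 = 1 →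
      (a = 0 ∨ b = 0 ∨ a ^ 2 = b ^ 2) →
      R (EuclideanSpace.single 0 1) = a • EuclideanSpace.single 0 1 + b • EuclideanSpace.single 1 1 →
      (Literature.MathematicalPhysics.QuantumLattice.SchwingerFamily.toLabelled
        (fun n => (S n (fun _ => r.curvature)).comp
          (Literature.MathematicalPhysics.QuantumLattice.linActMulti R))).IsReflectionPositive := by
    intro R a b hab hcase hR
    rcases hcase with h0 | h0 | h0
    · exact hAxis R a b hab (Or.inl h0) hR
    · exact hAxis R a b hab (Or.inr h0) hR
    · have ha : a ^ 2 = 1 / 2 := by linarith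
      have hb : b ^ 2 = 1 / 2 := by linarith
      exact hdiag R a b ha hb hR
  obtain ⟨hnorm₁, hherm₁, hgrowth₁, hrp₁, hsymm₁, hclus₁⟩ := hpkg₁
  obtain ⟨K, C, η, hη, hcont, hbd, hrep⟩ := hKB G hG r sch (fun n => S n (fun _ => r.curvature))
    ⟨hconv₁, ⟨hnorm₁, hherm₁, hgrowth₁, hrp₁, hsymm₁, hclus₁⟩, htr₁, hhyp₁, Δ₁, hΔ₁, hgap₁, hlat₁⟩
  obtain ⟨hB4, hpos0, hposD⟩ := hKT (fun n => S n (fun _ => r.curvature)) K hcont hrep hsymm₁ hhyp₁ h8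
  have hiso := hSR K hcont ⟨C, η, hη, hbd⟩ hB4 hpos0 hposD
  have hplanar := hNP G hG r sch (fun n => S n (fun _ => r.curvature))
    ⟨hconv₁, ⟨hnorm₁, hherm₁, hgrowth₁, hrp₁, hsymm₁, hclus₁⟩, htr₁, hhyp₁, Δ₁, hΔ₁, hgap₁, hlat₁⟩ h8
    ⟨K, hcont, hiso, hrep⟩
  obtain ⟨⟨hnorm, hherm, hgrowth, hrp, hsymm, hclus, htr, hhyp⟩, hconv, hnt, hng, Δ, hΔ, hgap, hlat⟩ := hW
  have hrot : ∀ (R : EuclideanSpace ℝ (Fin 4) ≃ₗᵢ[ℝ] EuclideanSpace ℝ (Fin 4)),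
      LinearMap.det (R.toLinearEquiv : EuclideanSpace ℝ (Fin 4) →ₗ[ℝ] EuclideanSpace ℝ (Fin 4)) = 1 →
      R (EuclideanSpace.single 2 1) = EuclideanSpace.single 2 1 →
      R (EuclideanSpace.single 3 1) = EuclideanSpace.single 3 1 →
      ∀ (n : ℕ) (k : Fin n → Literature.MathematicalPhysics.QuantumFieldTheory.YMSpecies G)
        (F : SchwartzMap (Fin n → EuclideanSpace ℝ (Fin 4)) ℂ),
        Literature.MathematicalPhysics.AQFT.IsOffDiagonal F →
          S n k (Literature.MathematicalPhysics.QuantumLattice.linActMulti R F) = S n k F := by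
    intro R hdet h2 h3 n k F hF
    by_cases hk : ∀ i, k i = r.curvature
    · have hk' : k = fun _ => r.curvature := funext hk
      subst hk'
      exact hplanar R hdet h2 h3 n F hF
    · push Not at hk
      exact (hzero n k hk _).trans (hzero n k hk _).symm
  have hE1 : S.IsEuclideanInvariant :=
    ⟨htr, fun n k R hdet F hF =>
      hPE (Literature.MathematicalPhysics.QuantumFieldTheory.YMSpecies G) S hhyp hrot n k R hdet F hF⟩
  exact ⟨r, sch, ⟨S, hnorm, hherm, hgrowth, hE1, hrp, hsymm, hclus⟩, hweak, hconv, hnt, hng, Δ, hΔ,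
    hgap, hlat⟩

/-- **`PencilRigidity` closes from the SLICE** (witness = the leg's; its diagonal conjunct from the slice fed `W₁` of `hCC`). -/
theorem closes_of_slice (hSR : ShellRigidity) (hNP : NPointIsotropy) (hKB : CurvatureKernelBound)
    (hSlice : (∀ (G : Type) [Group G] [TopologicalSpace G] [IsTopologicalGroup G] [CompactSpace G],
        IsCompactSimpleLieGroup G →
          letI : MeasurableSpace G := borel G
          haveI : BorelSpace G := ⟨rfl⟩
          ∀ (r : LatticeRep G) (sch : SpeciesScheme (YMSpecies G)) (S₁ : SchwingerFamily E4),
            CurvaturePackage r sch S₁ → sch.HasWeakCouplingLimit → DiagonalFrameRP S₁))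
    (hWHL : WeakCouplingHypercubicLimit) (hCC : CurvatureChannel) (hKT : KernelTransfer) (hPE : PlanarToEuclidean) :
    YangMills := by
  refine closes_of_diagWitness hSR hNP hKB ?_ hCC hKT hPE
  intro E G _ _ _ _ hG
  letI : MeasurableSpace G := borel G
  haveI : BorelSpace G := ⟨rfl⟩
  obtain ⟨r, sch, S, hweak, hzero, hW⟩ := hWHL G hG
  exact ⟨r, sch, S, hweak, hSlice G hG r sch (fun n => S n (fun _ => r.curvature)) (hCC G hG r sch S hW).1 hweak,
    hzero, hW⟩

/-- **`PencilRigidity` closes from the crux AS TYPED through its slice only** (= the route's `closes`, factored). -/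
theorem closes_via_slice (hSR : ShellRigidity) (hNP : NPointIsotropy) (hKB : CurvatureKernelBound)
    (hDiag : DiagonalMirrorRPR) (hWHL : WeakCouplingHypercubicLimit) (hCC : CurvatureChannel) (hKT : KernelTransfer)
    (hPE : PlanarToEuclidean) : YangMills :=
  closes_of_slice hSR hNP hKB (slice_of_crux hDiag) hWHL hCC hKT hPE

/-- **`PencilRigidity` closes from the RESTATED crux and the existence leg WITH the cover clause** (the leg VERBATIM with the
cover convergence conjoined right after `sch.HasWeakCouplingLimit`) — the deciding theorem of the option-A repair. -/
theorem closes_restated (hSR : ShellRigidity) (hNP : NPointIsotropy) (hKB : CurvatureKernelBound)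
    (hDiag : (∀ (G : Type) [Group G] [TopologicalSpace G] [IsTopologicalGroup G] [CompactSpace G],
      IsCompactSimpleLieGroup G →
        letI : MeasurableSpace G := borel G
        haveI : BorelSpace G := ⟨rfl⟩
        ∀ (r : LatticeRep G) (sch : SpeciesScheme (YMSpecies G)) (S₁ : SchwingerFamily E4),
          CurvaturePackage r sch S₁ → sch.HasWeakCouplingLimit →
            (∀ (n : ℕ), n ≠ 0 → ∀ (f : Fin n → 𝓢(E4, ℝ)) (F : 𝓢((Fin n → E4), ℂ)),
              IsTensorOf F (fun i => ofRealTest (f i)) → IsOffDiagonal F →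
                Tendsto (fun k : ℕ =>
                  ((tiltedLatticeSchwinger r.ρ sch (fun s => s.F) k n (fun _ => r.curvature) f : ℝ) : ℂ))
                  atTop (𝓝 (S₁ n F))) →
              DiagonalFrameRP S₁))
    (hWHLC : open Literature.MathematicalPhysics.QuantumLattice Literature.MathematicalPhysics.AQFT Literature.MathematicalPhysics.QuantumFieldTheory in let E := EuclideanSpace ℝ (Fin 4); ∀ (G : Type) [Group G] [TopologicalSpace G] [IsTopologicalGroup G] [CompactSpace G], IsCompactSimpleLieGroup G → letI : MeasurableSpace G := borel G; haveI : BorelSpace G := ⟨rfl⟩; ∃ (r : LatticeRep G) (sch : SpeciesScheme (YMSpecies G)) (S : LabelledSchwingerFamily (YMSpecies G) (E)), sch.HasWeakCouplingLimit ∧ (∀ (n : ℕ), n ≠ 0 → ∀ (f : Fin n → SchwartzMap (E) ℝ) (F : SchwartzMap (Fin n → E) ℂ), IsTensorOf F (fun i => ofRealTest (f i)) → IsOffDiagonal F → Filter.Tendsto (fun k : ℕ => ((tiltedLatticeSchwinger r.ρ sch (fun s => s.F) k n (fun _ => r.curvature) f : ℝ) : ℂ)) Filter.atTop (nhds (S n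 (fun _ => r.curvature) F))) ∧ (∀ (n : ℕ) (k : Fin n → YMSpecies G), (∃ i, k i ≠ r.curvature) → ∀ F : SchwartzMap (Fin n → E) ℂ, S n k F = 0) ∧ (S.IsNormalized ∧ S.IsHermitian ∧ S.HasLinearGrowth ∧ S.IsReflectionPositive ∧ S.IsSymmetric ∧ S.HasClusterProperty ∧ (∀ (n : ℕ) (k : Fin n → YMSpecies G) (a : E) (F : SchwartzMap (Fin n → E) ℂ), IsOffDiagonal F → S n k (translateMulti a F) = S n k F) ∧ (∀ (n : ℕ) (k : Fin n → YMSpecies G) (R : E ≃ₗᵢ[ℝ] E), LinearMap.det (R.toLinearEquiv : E →ₗ[ℝ] E) = 1 → (∀ i : Fin 4, ∃ j : Fin 4, R (EuclideanSpace.single i 1) = EuclideanSpace.single j 1 ∨ R (EuclideanSpace.single i 1) = -EuclideanSpace.single j 1) → ∀ F : SchwartzMap (Fin n → E) ℂ, IsOffDiagonal F → S n k (linActMulti R F) = S n k F)) ∧ (∀ (n : ℕ), n ≠ 0 → ∀ (σ : Fin n → YMSpecies G) (f : Fin n → SchwartzMap (E) ℝ) (F : SchwartzMap (Fin n → E) ℂ),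 IsTensorOf F (fun i => ofRealTest (f i)) → IsOffDiagonal F → Filter.Tendsto (fun k : ℕ => ((latticeSchwinger r.ρ sch (fun s => s.F) k n σ f : ℝ) : ℂ)) Filter.atTop (nhds (S n σ F))) ∧ (∃ (F₁ G₁ : SchwartzMap (Fin 1 → E) ℂ) (H₁ : SchwartzMap (Fin (1 + 1) → E) ℂ), IsTimeOrdered F₁ ∧ IsTimeOrdered G₁ ∧ IsAppendTensorOf H₁ (osAdjoint F₁) G₁ ∧ S (1 + 1) (fun _ => r.curvature) H₁ ≠ S 1 (fun _ => r.curvature) (osAdjoint F₁) * S 1 (fun _ => r.curvature) G₁) ∧ (∃ (f g h : SchwartzMap (E) ℂ) (Ffgh : SchwartzMap (Fin 3 → E) ℂ) (Fgh Ffh Ffg : SchwartzMap (Fin 2 → E) ℂ) (Ff Fg Fh : SchwartzMap (Fin 1 → E) ℂ), IsTensorOf Ffgh ![f, g, h] ∧ IsOffDiagonal Ffgh ∧ IsTensorOf Fgh ![g, h] ∧ IsTensorOf Ffh ![f, h] ∧ IsTensorOf Ffg ![f, g] ∧ IsTensorOf Ff ![f] ∧ IsTensorOf Fg ![g] ∧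 IsTensorOf Fh ![h] ∧ S 3 (fun _ => r.curvature) Ffgh - S 1 (fun _ => r.curvature) Ff * S 2 (fun _ => r.curvature) Fgh - S 1 (fun _ => r.curvature) Fg * S 2 (fun _ => r.curvature) Ffh - S 1 (fun _ => r.curvature) Fh * S 2 (fun _ => r.curvature) Ffg + 2 * (S 1 (fun _ => r.curvature) Ff * S 1 (fun _ => r.curvature) Fg * S 1 (fun _ => r.curvature) Fh) ≠ 0) ∧ (∃ Δ : ℝ, 0 < Δ ∧ S.HasMassGap Δ ∧ HasLatticeMassGap r sch Δ))
    (hCC : CurvatureChannel) (hKT : KernelTransfer) (hPE : PlanarToEuclidean) : YangMills := by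
  refine closes_of_diagWitness hSR hNP hKB ?_ hCC hKT hPE
  intro E G _ _ _ _ hG
  letI : MeasurableSpace G := borel G
  haveI : BorelSpace G := ⟨rfl⟩
  obtain ⟨r, sch, S, hweak, hcover, hzero, hW⟩ := hWHLC G hG
  exact ⟨r, sch, S, hweak,
    hDiag G hG r sch (fun n => S n (fun _ => r.curvature)) (hCC G hG r sch S hW).1 hweak hcover, hzero, hW⟩

/-- **`PencilRigidity` closes WITHOUT any diagonal binder** once the existence leg carries the cover clause. -/
theorem closes_without_diag (hSR : ShellRigidity) (hNP : NPointIsotropy) (hKB : CurvatureKernelBound)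
    (hWHLC : open Literature.MathematicalPhysics.QuantumLattice Literature.MathematicalPhysics.AQFT Literature.MathematicalPhysics.QuantumFieldTheory in let E := EuclideanSpace ℝ (Fin 4); ∀ (G : Type) [Group G] [TopologicalSpace G] [IsTopologicalGroup G] [CompactSpace G], IsCompactSimpleLieGroup G → letI : MeasurableSpace G := borel G; haveI : BorelSpace G := ⟨rfl⟩; ∃ (r : LatticeRep G) (sch : SpeciesScheme (YMSpecies G)) (S : LabelledSchwingerFamily (YMSpecies G) (E)), sch.HasWeakCouplingLimit ∧ (∀ (n : ℕ), n ≠ 0 → ∀ (f : Fin n → SchwartzMap (E) ℝ) (F : SchwartzMap (Fin n → E) ℂ), IsTensorOf F (fun i => ofRealTest (f i)) → IsOffDiagonal F → Filter.Tendsto (fun k : ℕ => ((tiltedLatticeSchwinger r.ρ sch (fun s => s.F) k n (fun _ => r.curvature) f : ℝ) : ℂ)) Filter.atTop (nhds (S n (fun _ => r.curvature) F))) ∧ (∀ (n : ℕ) (k : Fin n → YMSpecies G), (∃ i, k i ≠ r.curvature) → ∀ F : SchwartzMap (Fin n → E) ℂ, S n k F = 0) ∧ (S.IsNormalized ∧ S.IsHermitian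 ∧ S.HasLinearGrowth ∧ S.IsReflectionPositive ∧ S.IsSymmetric ∧ S.HasClusterProperty ∧ (∀ (n : ℕ) (k : Fin n → YMSpecies G) (a : E) (F : SchwartzMap (Fin n → E) ℂ), IsOffDiagonal F → S n k (translateMulti a F) = S n k F) ∧ (∀ (n : ℕ) (k : Fin n → YMSpecies G) (R : E ≃ₗᵢ[ℝ] E), LinearMap.det (R.toLinearEquiv : E →ₗ[ℝ] E) = 1 → (∀ i : Fin 4, ∃ j : Fin 4, R (EuclideanSpace.single i 1) = EuclideanSpace.single j 1 ∨ R (EuclideanSpace.single i 1) = -EuclideanSpace.single j 1) → ∀ F : SchwartzMap (Fin n → E) ℂ, IsOffDiagonal F → S n k (linActMulti R F) = S n k F)) ∧ (∀ (n : ℕ), n ≠ 0 → ∀ (σ : Fin n → YMSpecies G) (f : Fin n → SchwartzMap (E) ℝ) (F : SchwartzMap (Fin n → E) ℂ), IsTensorOf F (fun i => ofRealTest (f i)) → IsOffDiagonal F → Filter.Tendsto (fun k : ℕ => ((latticeSchwinger r.ρ sch (fun s => s.F) k n σ f : ℝ) : ℂ)) Filter.atTop (nhds (S n σ F))) ∧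 (∃ (F₁ G₁ : SchwartzMap (Fin 1 → E) ℂ) (H₁ : SchwartzMap (Fin (1 + 1) → E) ℂ), IsTimeOrdered F₁ ∧ IsTimeOrdered G₁ ∧ IsAppendTensorOf H₁ (osAdjoint F₁) G₁ ∧ S (1 + 1) (fun _ => r.curvature) H₁ ≠ S 1 (fun _ => r.curvature) (osAdjoint F₁) * S 1 (fun _ => r.curvature) G₁) ∧ (∃ (f g h : SchwartzMap (E) ℂ) (Ffgh : SchwartzMap (Fin 3 → E) ℂ) (Fgh Ffh Ffg : SchwartzMap (Fin 2 → E) ℂ) (Ff Fg Fh : SchwartzMap (Fin 1 → E) ℂ), IsTensorOf Ffgh ![f, g, h] ∧ IsOffDiagonal Ffgh ∧ IsTensorOf Fgh ![g, h] ∧ IsTensorOf Ffh ![f, h] ∧ IsTensorOf Ffg ![f, g] ∧ IsTensorOf Ff ![f] ∧ IsTensorOf Fg ![g] ∧ IsTensorOf Fh ![h] ∧ S 3 (fun _ => r.curvature) Ffgh - S 1 (fun _ => r.curvature) Ff * S 2 (fun _ => r.curvature) Fgh - S 1 (fun _ => r.curvature) Fg * S 2 (fun _ => r.curvature) Ffh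 - S 1 (fun _ => r.curvature) Fh * S 2 (fun _ => r.curvature) Ffg + 2 * (S 1 (fun _ => r.curvature) Ff * S 1 (fun _ => r.curvature) Fg * S 1 (fun _ => r.curvature) Fh) ≠ 0) ∧ (∃ Δ : ℝ, 0 < Δ ∧ S.HasMassGap Δ ∧ HasLatticeMassGap r sch Δ))
    (hCC : CurvatureChannel) (hKT : KernelTransfer) (hPE : PlanarToEuclidean) : YangMills :=
  closes_restated hSR hNP hKB restatedSlice_holds hWHLC hCC hKT hPE

end PencilRigidity

/-! ## §4 Route `MirrorModularBoosts` (and `IsotropyFromPowerCounting`, whose `closes` is `MirrorModularBoosts.closes`) -/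

section MirrorModularBoosts

open Summit.QuantumFields.YangMills.Theses.MirrorModularBoosts
open _root_.Summit.QuantumFields.YangMills.Theorems.HypercubicLimit.Negative

/-- **`MirrorModularBoosts` closes from ONE diagonally-RP weak-coupling witness** (its `closes` verbatim, leg + conjunct). -/
theorem closes_of_diagWitness_mmb (hKB : CurvatureKernelBound) (hSoft : SoftKernelBoostCovariance)
    (hCone : PlanarSpectralCone)
    (hWit : open Literature.MathematicalPhysics.QuantumLattice Literature.MathematicalPhysics.AQFT Literature.MathematicalPhysics.QuantumFieldTheory in let E := EuclideanSpace ℝ (Fin 4); ∀ (G : Type) [Group G] [TopologicalSpace G] [IsTopologicalGroup G] [CompactSpace G], IsCompactSimpleLieGroup G → letI : MeasurableSpace G := borel G; haveI : BorelSpace G := ⟨rfl⟩; ∃ (r : LatticeRep G) (sch : SpeciesScheme (YMSpecies G)) (S : LabelledSchwingerFamily (YMSpecies G) (E)), sch.HasWeakCouplingLimit ∧ DiagonalFrameRP (fun n => S n (fun _ => r.curvature)) ∧ (S.IsNormalized ∧ S.IsHermitian ∧ S.HasLinearGrowth ∧ S.IsReflectionPositive ∧ S.IsSymmetric ∧ S.HasClusterProperty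 ∧ (∀ (n : ℕ) (k : Fin n → YMSpecies G) (a : E) (F : SchwartzMap (Fin n → E) ℂ), IsOffDiagonal F → S n k (translateMulti a F) = S n k F) ∧ (∀ (n : ℕ) (k : Fin n → YMSpecies G) (R : E ≃ₗᵢ[ℝ] E), LinearMap.det (R.toLinearEquiv : E →ₗ[ℝ] E) = 1 → (∀ i : Fin 4, ∃ j : Fin 4, R (EuclideanSpace.single i 1) = EuclideanSpace.single j 1 ∨ R (EuclideanSpace.single i 1) = -EuclideanSpace.single j 1) → ∀ F : SchwartzMap (Fin n → E) ℂ, IsOffDiagonal F → S n k (linActMulti R F) = S n k F)) ∧ (∀ (n : ℕ), n ≠ 0 → ∀ (σ : Fin n → YMSpecies G) (f : Fin n → SchwartzMap (E) ℝ) (F : SchwartzMap (Fin n → E) ℂ), IsTensorOf F (fun i => ofRealTest (f i)) → IsOffDiagonal F → Filter.Tendsto (fun k : ℕ => ((latticeSchwinger r.ρ sch (fun s => s.F) k n σ f : ℝ) : ℂ)) Filter.atTop (nhds (S n σ F))) ∧ (∃ (F₁ G₁ : SchwartzMap (Fin 1 → E) ℂ) (H₁ : SchwartzMap (Fin (1 +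 1) → E) ℂ), IsTimeOrdered F₁ ∧ IsTimeOrdered G₁ ∧ IsAppendTensorOf H₁ (osAdjoint F₁) G₁ ∧ S (1 + 1) (fun _ => r.curvature) H₁ ≠ S 1 (fun _ => r.curvature) (osAdjoint F₁) * S 1 (fun _ => r.curvature) G₁) ∧ (∃ (f g h : SchwartzMap (E) ℂ) (Ffgh : SchwartzMap (Fin 3 → E) ℂ) (Fgh Ffh Ffg : SchwartzMap (Fin 2 → E) ℂ) (Ff Fg Fh : SchwartzMap (Fin 1 → E) ℂ), IsTensorOf Ffgh ![f, g, h] ∧ IsOffDiagonal Ffgh ∧ IsTensorOf Fgh ![g, h] ∧ IsTensorOf Ffh ![f, h] ∧ IsTensorOf Ffg ![f, g] ∧ IsTensorOf Ff ![f] ∧ IsTensorOf Fg ![g] ∧ IsTensorOf Fh ![h] ∧ S 3 (fun _ => r.curvature) Ffgh - S 1 (fun _ => r.curvature) Ff * S 2 (fun _ => r.curvature) Fgh - S 1 (fun _ => r.curvature) Fg * S 2 (fun _ => r.curvature) Ffh - S 1 (fun _ => r.curvature) Fh * S 2 (fun _ => r.curvature) Ffg + 2 * (S 1 (fun _ =>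 r.curvature) Ff * S 1 (fun _ => r.curvature) Fg * S 1 (fun _ => r.curvature) Fh) ≠ 0) ∧ (∃ Δ : ℝ, 0 < Δ ∧ S.HasMassGap Δ ∧ HasLatticeMassGap r sch Δ)) :
    YangMills := by
  have hCC : CurvatureChannel := _root_.Summit.QuantumFields.YangMills.Theorems.curvatureChannel_proof
  have hPE : PlanarToEuclidean := _root_.Summit.QuantumFields.YangMills.Theorems.PlanarToEuclidean_proof
  have hEng : CurvatureBoostCovariance := by
    intro G _ _ _ _ hG
    letI : MeasurableSpace G := borel G
    haveI : BorelSpace G := ⟨rfl⟩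
    intro W₁ r sch S₁ hW₁ h8 hcone
    exact hSoft G hG r sch S₁ hW₁ h8 hcone (hKB G hG r sch S₁ hW₁)
  intro G i1 i2 i3 i4 hG
  letI : MeasurableSpace G := borel G
  haveI : BorelSpace G := ⟨rfl⟩
  obtain ⟨r, sch, S, hweak, hdiag, hW⟩ := hWit G hG
  obtain ⟨hW₁, hAxis⟩ := hCC G hG r sch S hW
  obtain ⟨hconv₁, hpkg₁, htr₁, hhyp₁, Δ₁, hΔ₁, hgap₁, hlat₁⟩ := hW₁
  have h8 : ∀ (R : EuclideanSpace ℝ (Fin 4) ≃ₗᵢ[ℝ] EuclideanSpace ℝ (Fin 4)) (a b : ℝ), a ^ 2 + b ^ 2 = 1 →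
      (a = 0 ∨ b = 0 ∨ a ^ 2 = b ^ 2) →
      R (EuclideanSpace.single 0 1) = a • EuclideanSpace.single 0 1 + b • EuclideanSpace.single 1 1 →
      (Literature.MathematicalPhysics.QuantumLattice.SchwingerFamily.toLabelled
        (fun n => (S n (fun _ => r.curvature)).comp
          (Literature.MathematicalPhysics.QuantumLattice.linActMulti R))).IsReflectionPositive := by
    intro R a b hab hcase hR
    rcases hcase with h0 | h0 | h0
    · exact hAxis R a b hab (Or.inl h0) hR
    · exact hAxis R a b hab (Or.inr h0) hR
    · have ha : a ^ 2 = 1 / 2 := by linarith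
      have hb : b ^ 2 = 1 / 2 := by linarith
      exact hdiag R a b ha hb hR
  obtain ⟨hnorm₁, hherm₁, hgrowth₁, hrp₁, hsymm₁, hclus₁⟩ := hpkg₁
  have hcone := hCone (fun n => S n (fun _ => r.curvature)) hgrowth₁ hsymm₁ htr₁ h8
  have hplanar := hEng G hG r sch (fun n => S n (fun _ => r.curvature))
    ⟨hconv₁, ⟨hnorm₁, hherm₁, hgrowth₁, hrp₁, hsymm₁, hclus₁⟩, htr₁, hhyp₁, Δ₁, hΔ₁, hgap₁, hlat₁⟩ h8 hcone
  obtain ⟨⟨hnorm, hherm, hgrowth, hrp, hsymm, hclus, htr, hhyp⟩, hconv, hnt, hng, Δ, hΔ, hgap, hlat⟩ :=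
    clauses_of_clauses₁ (clauses₁_of_clauses hW)
  have hrot' : ∀ (R : EuclideanSpace ℝ (Fin 4) ≃ₗᵢ[ℝ] EuclideanSpace ℝ (Fin 4)),
      LinearMap.det (R.toLinearEquiv : EuclideanSpace ℝ (Fin 4) →ₗ[ℝ] EuclideanSpace ℝ (Fin 4)) = 1 →
      R (EuclideanSpace.single 2 1) = EuclideanSpace.single 2 1 →
      R (EuclideanSpace.single 3 1) = EuclideanSpace.single 3 1 →
      ∀ (n : ℕ) (k : Fin n → Literature.MathematicalPhysics.QuantumFieldTheory.YMSpecies G)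
        (F : SchwartzMap (Fin n → EuclideanSpace ℝ (Fin 4)) ℂ),
        Literature.MathematicalPhysics.AQFT.IsOffDiagonal F →
        extendByZero r.curvature (restrictTo r.curvature S) n k
            (Literature.MathematicalPhysics.QuantumLattice.linActMulti R F) =
          extendByZero r.curvature (restrictTo r.curvature S) n k F := by
    intro R hdet h2 h3 n k F hF
    by_cases hk : ∀ i, k i = r.curvature
    · rw [extendByZero_of_all r.curvature _ hk]
      exact hplanar R hdet h2 h3 n F hF
    · rw [extendByZero_of_not_all r.curvature _ hk]
      rfl
  have hE1 : (extendByZero r.curvature (restrictTo r.curvature S)).IsEuclideanInvariant :=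
    ⟨htr, fun n k R hdet F hF =>
      hPE (Literature.MathematicalPhysics.QuantumFieldTheory.YMSpecies G) _ hhyp hrot' n k R hdet F hF⟩
  have hweak' : (onlySpecies sch r.curvature).HasWeakCouplingLimit := hweak
  exact ⟨r, _, ⟨_, hnorm, hherm, hgrowth, hE1, hrp, hsymm, hclus⟩, hweak', hconv, hnt, hng, Δ, hΔ, hgap, hlat⟩

/-- **`MirrorModularBoosts` closes from the SLICE.** -/
theorem closes_of_slice_mmb (hKB : CurvatureKernelBound) (hSoft : SoftKernelBoostCovariance) (hCone : PlanarSpectralCone)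
    (hSlice : (∀ (G : Type) [Group G] [TopologicalSpace G] [IsTopologicalGroup G] [CompactSpace G],
        IsCompactSimpleLieGroup G →
          letI : MeasurableSpace G := borel G
          haveI : BorelSpace G := ⟨rfl⟩
          ∀ (r : LatticeRep G) (sch : SpeciesScheme (YMSpecies G)) (S₁ : SchwingerFamily E4),
            CurvaturePackage r sch S₁ → sch.HasWeakCouplingLimit → DiagonalFrameRP S₁))
    (hWHL : WeakCouplingHypercubicLimit) : YangMills := by
  refine closes_of_diagWitness_mmb hKB hSoft hCone ?_
  intro E G _ _ _ _ hG
  letI : MeasurableSpace G := borel G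
  haveI : BorelSpace G := ⟨rfl⟩
  obtain ⟨r, sch, S, hweak, hW⟩ := hWHL G hG
  exact ⟨r, sch, S, hweak, hSlice G hG r sch (fun n => S n (fun _ => r.curvature))
    (_root_.Summit.QuantumFields.YangMills.Theorems.curvatureChannel_proof G hG r sch S hW).1 hweak, hW⟩

/-- **`MirrorModularBoosts` closes from the crux AS TYPED through its slice only** (= the route's `closes`, factored). -/
theorem closes_via_slice_mmb (hKB : CurvatureKernelBound) (hSoft : SoftKernelBoostCovariance)
    (hCone : PlanarSpectralCone) (hDiag : DiagonalMirrorRPR) (hWHL : WeakCouplingHypercubicLimit) : YangMills :=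
  closes_of_slice_mmb hKB hSoft hCone (slice_of_crux_mmb hDiag) hWHL

/-- **`MirrorModularBoosts` closes from the RESTATED crux and the existence leg WITH the cover clause.** -/
theorem closes_restated_mmb (hKB : CurvatureKernelBound) (hSoft : SoftKernelBoostCovariance) (hCone : PlanarSpectralCone)
    (hDiag : (∀ (G : Type) [Group G] [TopologicalSpace G] [IsTopologicalGroup G] [CompactSpace G],
      IsCompactSimpleLieGroup G →
        letI : MeasurableSpace G := borel G
        haveI : BorelSpace G := ⟨rfl⟩
        ∀ (r : LatticeRep G) (sch : SpeciesScheme (YMSpecies G)) (S₁ : SchwingerFamily E4),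
          CurvaturePackage r sch S₁ → sch.HasWeakCouplingLimit →
            (∀ (n : ℕ), n ≠ 0 → ∀ (f : Fin n → 𝓢(E4, ℝ)) (F : 𝓢((Fin n → E4), ℂ)),
              IsTensorOf F (fun i => ofRealTest (f i)) → IsOffDiagonal F →
                Tendsto (fun k : ℕ =>
                  ((tiltedLatticeSchwinger r.ρ sch (fun s => s.F) k n (fun _ => r.curvature) f : ℝ) : ℂ))
                  atTop (𝓝 (S₁ n F))) →
              DiagonalFrameRP S₁))
    (hWHLC : open Literature.MathematicalPhysics.QuantumLattice Literature.MathematicalPhysics.AQFT Literature.MathematicalPhysics.QuantumFieldTheory in let E := EuclideanSpace ℝ (Fin 4); ∀ (G : Type) [Group G] [TopologicalSpace G] [IsTopologicalGroup G] [CompactSpace G], IsCompactSimpleLieGroup G → letI : MeasurableSpace G := borel G; haveI : BorelSpace G := ⟨rfl⟩; ∃ (r : LatticeRep G) (sch : SpeciesScheme (YMSpecies G)) (S : LabelledSchwingerFamily (YMSpecies G) (E)), sch.HasWeakCouplingLimit ∧ (∀ (n : ℕ), n ≠ 0 → ∀ (f : Fin n → SchwartzMap (E) ℝ) (F : SchwartzMap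 (Fin n → E) ℂ), IsTensorOf F (fun i => ofRealTest (f i)) → IsOffDiagonal F → Filter.Tendsto (fun k : ℕ => ((tiltedLatticeSchwinger r.ρ sch (fun s => s.F) k n (fun _ => r.curvature) f : ℝ) : ℂ)) Filter.atTop (nhds (S n (fun _ => r.curvature) F))) ∧ (S.IsNormalized ∧ S.IsHermitian ∧ S.HasLinearGrowth ∧ S.IsReflectionPositive ∧ S.IsSymmetric ∧ S.HasClusterProperty ∧ (∀ (n : ℕ) (k : Fin n → YMSpecies G) (a : E) (F : SchwartzMap (Fin n → E) ℂ), IsOffDiagonal F → S n k (translateMulti a F) = S n k F) ∧ (∀ (n : ℕ) (k : Fin n → YMSpecies G) (R : E ≃ₗᵢ[ℝ] E), LinearMap.det (R.toLinearEquiv : E →ₗ[ℝ] E) = 1 → (∀ i : Fin 4, ∃ j : Fin 4, R (EuclideanSpace.single i 1) = EuclideanSpace.single j 1 ∨ R (EuclideanSpace.single i 1) = -EuclideanSpace.single j 1) → ∀ F : SchwartzMap (Fin n → E) ℂ, IsOffDiagonal F → S n k (linActMulti R F) = S n k F)) ∧ (∀ (n : ℕ), n ≠ 0 → ∀ (σ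 : Fin n → YMSpecies G) (f : Fin n → SchwartzMap (E) ℝ) (F : SchwartzMap (Fin n → E) ℂ), IsTensorOf F (fun i => ofRealTest (f i)) → IsOffDiagonal F → Filter.Tendsto (fun k : ℕ => ((latticeSchwinger r.ρ sch (fun s => s.F) k n σ f : ℝ) : ℂ)) Filter.atTop (nhds (S n σ F))) ∧ (∃ (F₁ G₁ : SchwartzMap (Fin 1 → E) ℂ) (H₁ : SchwartzMap (Fin (1 + 1) → E) ℂ), IsTimeOrdered F₁ ∧ IsTimeOrdered G₁ ∧ IsAppendTensorOf H₁ (osAdjoint F₁) G₁ ∧ S (1 + 1) (fun _ => r.curvature) H₁ ≠ S 1 (fun _ => r.curvature) (osAdjoint F₁) * S 1 (fun _ => r.curvature) G₁) ∧ (∃ (f g h : SchwartzMap (E) ℂ) (Ffgh : SchwartzMap (Fin 3 → E) ℂ) (Fgh Ffh Ffg : SchwartzMap (Fin 2 → E) ℂ) (Ff Fg Fh : SchwartzMap (Fin 1 → E) ℂ), IsTensorOf Ffgh ![f, g, h] ∧ IsOffDiagonal Ffgh ∧ IsTensorOf Fgh ![g, h] ∧ IsTensorOf Ffh ![f, h]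 ∧ IsTensorOf Ffg ![f, g] ∧ IsTensorOf Ff ![f] ∧ IsTensorOf Fg ![g] ∧ IsTensorOf Fh ![h] ∧ S 3 (fun _ => r.curvature) Ffgh - S 1 (fun _ => r.curvature) Ff * S 2 (fun _ => r.curvature) Fgh - S 1 (fun _ => r.curvature) Fg * S 2 (fun _ => r.curvature) Ffh - S 1 (fun _ => r.curvature) Fh * S 2 (fun _ => r.curvature) Ffg + 2 * (S 1 (fun _ => r.curvature) Ff * S 1 (fun _ => r.curvature) Fg * S 1 (fun _ => r.curvature) Fh) ≠ 0) ∧ (∃ Δ : ℝ, 0 < Δ ∧ S.HasMassGap Δ ∧ HasLatticeMassGap r sch Δ)) :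
    YangMills := by
  refine closes_of_diagWitness_mmb hKB hSoft hCone ?_
  intro E G _ _ _ _ hG
  letI : MeasurableSpace G := borel G
  haveI : BorelSpace G := ⟨rfl⟩
  obtain ⟨r, sch, S, hweak, hcover, hW⟩ := hWHLC G hG
  exact ⟨r, sch, S, hweak, hDiag G hG r sch (fun n => S n (fun _ => r.curvature))
    (_root_.Summit.QuantumFields.YangMills.Theorems.curvatureChannel_proof G hG r sch S hW).1 hweak hcover, hW⟩

/-- **`MirrorModularBoosts` closes WITHOUT any diagonal binder** once the existence leg carries the cover clause. -/
theorem closes_without_diag_mmb (hKB : CurvatureKernelBound) (hSoft : SoftKernelBoostCovariance)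
    (hCone : PlanarSpectralCone)
    (hWHLC : open Literature.MathematicalPhysics.QuantumLattice Literature.MathematicalPhysics.AQFT Literature.MathematicalPhysics.QuantumFieldTheory in let E := EuclideanSpace ℝ (Fin 4); ∀ (G : Type) [Group G] [TopologicalSpace G] [IsTopologicalGroup G] [CompactSpace G], IsCompactSimpleLieGroup G → letI : MeasurableSpace G := borel G; haveI : BorelSpace G := ⟨rfl⟩; ∃ (r : LatticeRep G) (sch : SpeciesScheme (YMSpecies G)) (S : LabelledSchwingerFamily (YMSpecies G) (E)), sch.HasWeakCouplingLimit ∧ (∀ (n : ℕ), n ≠ 0 → ∀ (f : Fin n → SchwartzMap (E) ℝ) (F : SchwartzMap (Fin n → E) ℂ), IsTensorOf F (fun i => ofRealTest (f i)) → IsOffDiagonal F → Filter.Tendsto (fun k : ℕ => ((tiltedLatticeSchwinger r.ρ sch (fun s => s.F) k n (fun _ => r.curvature) f : ℝ) : ℂ)) Filter.atTop (nhds (S n (fun _ => r.curvature) F))) ∧ (S.IsNormalized ∧ S.IsHermitian ∧ S.HasLinearGrowth ∧ S.IsReflectionPositive ∧ S.IsSymmetric ∧ S.HasClusterProperty ∧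 (∀ (n : ℕ) (k : Fin n → YMSpecies G) (a : E) (F : SchwartzMap (Fin n → E) ℂ), IsOffDiagonal F → S n k (translateMulti a F) = S n k F) ∧ (∀ (n : ℕ) (k : Fin n → YMSpecies G) (R : E ≃ₗᵢ[ℝ] E), LinearMap.det (R.toLinearEquiv : E →ₗ[ℝ] E) = 1 → (∀ i : Fin 4, ∃ j : Fin 4, R (EuclideanSpace.single i 1) = EuclideanSpace.single j 1 ∨ R (EuclideanSpace.single i 1) = -EuclideanSpace.single j 1) → ∀ F : SchwartzMap (Fin n → E) ℂ, IsOffDiagonal F → S n k (linActMulti R F) = S n k F)) ∧ (∀ (n : ℕ), n ≠ 0 → ∀ (σ : Fin n → YMSpecies G) (f : Fin n → SchwartzMap (E) ℝ) (F : SchwartzMap (Fin n → E) ℂ), IsTensorOf F (fun i => ofRealTest (f i)) → IsOffDiagonal F → Filter.Tendsto (fun k : ℕ => ((latticeSchwinger r.ρ sch (fun s => s.F) k n σ f : ℝ) : ℂ)) Filter.atTop (nhds (S n σ F))) ∧ (∃ (F₁ G₁ : SchwartzMap (Fin 1 → E) ℂ) (H₁ : SchwartzMap (Fin (1 + 1)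 → E) ℂ), IsTimeOrdered F₁ ∧ IsTimeOrdered G₁ ∧ IsAppendTensorOf H₁ (osAdjoint F₁) G₁ ∧ S (1 + 1) (fun _ => r.curvature) H₁ ≠ S 1 (fun _ => r.curvature) (osAdjoint F₁) * S 1 (fun _ => r.curvature) G₁) ∧ (∃ (f g h : SchwartzMap (E) ℂ) (Ffgh : SchwartzMap (Fin 3 → E) ℂ) (Fgh Ffh Ffg : SchwartzMap (Fin 2 → E) ℂ) (Ff Fg Fh : SchwartzMap (Fin 1 → E) ℂ), IsTensorOf Ffgh ![f, g, h] ∧ IsOffDiagonal Ffgh ∧ IsTensorOf Fgh ![g, h] ∧ IsTensorOf Ffh ![f, h] ∧ IsTensorOf Ffg ![f, g] ∧ IsTensorOf Ff ![f] ∧ IsTensorOf Fg ![g] ∧ IsTensorOf Fh ![h] ∧ S 3 (fun _ => r.curvature) Ffgh - S 1 (fun _ => r.curvature) Ff * S 2 (fun _ => r.curvature) Fgh - S 1 (fun _ => r.curvature) Fg * S 2 (fun _ => r.curvature) Ffh - S 1 (fun _ => r.curvature) Fh * S 2 (fun _ => r.curvature) Ffg + 2 * (S 1 (fun _ => r.curvature)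 Ff * S 1 (fun _ => r.curvature) Fg * S 1 (fun _ => r.curvature) Fh) ≠ 0) ∧ (∃ Δ : ℝ, 0 < Δ ∧ S.HasMassGap Δ ∧ HasLatticeMassGap r sch Δ)) :
    YangMills :=
  closes_restated_mmb hKB hSoft hCone restatedSlice_holds hWHLC

end MirrorModularBoosts

section IsotropyFromPowerCounting

open Summit.QuantumFields.YangMills.Theses.IsotropyFromPowerCounting

/-- **`IsotropyFromPowerCounting` closes from the crux AS TYPED through its slice only.** -/
theorem closes_via_slice_ifpc (hSig : CurvatureSandwichBound) (hT : TemperedCurvatureMoments) (hK : CurvatureKernelBound)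
    (hD : DiagonalMirrorRPR) (hH : WeakCouplingHypercubicLimit) (hE : EngineFromPowerCounting) (hC : PlanarSpectralCone) :
    YangMills :=
  closes_of_slice_mmb hK (hE hT hSig) hC (slice_of_crux_ifpc hD) hH

/-- **`IsotropyFromPowerCounting` closes from the RESTATED crux and the existence leg WITH the cover clause.** -/
theorem closes_restated_ifpc (hSig : CurvatureSandwichBound) (hT : TemperedCurvatureMoments) (hK : CurvatureKernelBound)
    (hD : (∀ (G : Type) [Group G] [TopologicalSpace G] [IsTopologicalGroup G] [CompactSpace G],
      IsCompactSimpleLieGroup G →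
        letI : MeasurableSpace G := borel G
        haveI : BorelSpace G := ⟨rfl⟩
        ∀ (r : LatticeRep G) (sch : SpeciesScheme (YMSpecies G)) (S₁ : SchwingerFamily E4),
          CurvaturePackage r sch S₁ → sch.HasWeakCouplingLimit →
            (∀ (n : ℕ), n ≠ 0 → ∀ (f : Fin n → 𝓢(E4, ℝ)) (F : 𝓢((Fin n → E4), ℂ)),
              IsTensorOf F (fun i => ofRealTest (f i)) → IsOffDiagonal F →
                Tendsto (fun k : ℕ =>
                  ((tiltedLatticeSchwinger r.ρ sch (fun s => s.F) k n (fun _ => r.curvature) f : ℝ) : ℂ))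
                  atTop (𝓝 (S₁ n F))) →
              DiagonalFrameRP S₁))
    (hHC : open Literature.MathematicalPhysics.QuantumLattice Literature.MathematicalPhysics.AQFT Literature.MathematicalPhysics.QuantumFieldTheory in let E := EuclideanSpace ℝ (Fin 4); ∀ (G : Type) [Group G] [TopologicalSpace G] [IsTopologicalGroup G] [CompactSpace G], IsCompactSimpleLieGroup G → letI : MeasurableSpace G := borel G; haveI : BorelSpace G := ⟨rfl⟩; ∃ (r : LatticeRep G) (sch : SpeciesScheme (YMSpecies G)) (S : LabelledSchwingerFamily (YMSpecies G) (E)), sch.HasWeakCouplingLimit ∧ (∀ (n : ℕ), n ≠ 0 → ∀ (f : Fin n → SchwartzMap (E) ℝ) (F : SchwartzMap (Fin n → E) ℂ), IsTensorOf F (fun i => ofRealTest (f i)) → IsOffDiagonal F → Filter.Tendsto (fun k : ℕ => ((tiltedLatticeSchwinger r.ρ sch (fun s => s.F) k n (fun _ => r.curvature) f : ℝ) : ℂ)) Filter.atTop (nhds (S n (fun _ => r.curvature) F))) ∧ (S.IsNormalized ∧ S.IsHermitian ∧ S.HasLinearGrowth ∧ S.IsReflectionPositive ∧ S.IsSymmetric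 ∧ S.HasClusterProperty ∧ (∀ (n : ℕ) (k : Fin n → YMSpecies G) (a : E) (F : SchwartzMap (Fin n → E) ℂ), IsOffDiagonal F → S n k (translateMulti a F) = S n k F) ∧ (∀ (n : ℕ) (k : Fin n → YMSpecies G) (R : E ≃ₗᵢ[ℝ] E), LinearMap.det (R.toLinearEquiv : E →ₗ[ℝ] E) = 1 → (∀ i : Fin 4, ∃ j : Fin 4, R (EuclideanSpace.single i 1) = EuclideanSpace.single j 1 ∨ R (EuclideanSpace.single i 1) = -EuclideanSpace.single j 1) → ∀ F : SchwartzMap (Fin n → E) ℂ, IsOffDiagonal F → S n k (linActMulti R F) = S n k F)) ∧ (∀ (n : ℕ), n ≠ 0 → ∀ (σ : Fin n → YMSpecies G) (f : Fin n → SchwartzMap (E) ℝ) (F : SchwartzMap (Fin n → E) ℂ), IsTensorOf F (fun i => ofRealTest (f i)) → IsOffDiagonal F → Filter.Tendsto (fun k : ℕ => ((latticeSchwinger r.ρ sch (fun s => s.F) k n σ f : ℝ) : ℂ)) Filter.atTop (nhds (S n σ F))) ∧ (∃ (F₁ G₁ : SchwartzMap (Fin 1 → E) ℂ) (H₁ :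 SchwartzMap (Fin (1 + 1) → E) ℂ), IsTimeOrdered F₁ ∧ IsTimeOrdered G₁ ∧ IsAppendTensorOf H₁ (osAdjoint F₁) G₁ ∧ S (1 + 1) (fun _ => r.curvature) H₁ ≠ S 1 (fun _ => r.curvature) (osAdjoint F₁) * S 1 (fun _ => r.curvature) G₁) ∧ (∃ (f g h : SchwartzMap (E) ℂ) (Ffgh : SchwartzMap (Fin 3 → E) ℂ) (Fgh Ffh Ffg : SchwartzMap (Fin 2 → E) ℂ) (Ff Fg Fh : SchwartzMap (Fin 1 → E) ℂ), IsTensorOf Ffgh ![f, g, h] ∧ IsOffDiagonal Ffgh ∧ IsTensorOf Fgh ![g, h] ∧ IsTensorOf Ffh ![f, h] ∧ IsTensorOf Ffg ![f, g] ∧ IsTensorOf Ff ![f] ∧ IsTensorOf Fg ![g] ∧ IsTensorOf Fh ![h] ∧ S 3 (fun _ => r.curvature) Ffgh - S 1 (fun _ => r.curvature) Ff * S 2 (fun _ => r.curvature) Fgh - S 1 (fun _ => r.curvature) Fg * S 2 (fun _ => r.curvature) Ffh - S 1 (fun _ => r.curvature) Fh * S 2 (fun _ => r.curvature) Ffg +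 2 * (S 1 (fun _ => r.curvature) Ff * S 1 (fun _ => r.curvature) Fg * S 1 (fun _ => r.curvature) Fh) ≠ 0) ∧ (∃ Δ : ℝ, 0 < Δ ∧ S.HasMassGap Δ ∧ HasLatticeMassGap r sch Δ))
    (hE : EngineFromPowerCounting) (hC : PlanarSpectralCone) : YangMills :=
  closes_restated_mmb hK (hE hT hSig) hC hD hHC

/-- **`IsotropyFromPowerCounting` closes WITHOUT any diagonal binder.** -/
theorem closes_without_diag_ifpc (hSig : CurvatureSandwichBound) (hT : TemperedCurvatureMoments)
    (hK : CurvatureKernelBound)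
    (hHC : open Literature.MathematicalPhysics.QuantumLattice Literature.MathematicalPhysics.AQFT Literature.MathematicalPhysics.QuantumFieldTheory in let E := EuclideanSpace ℝ (Fin 4); ∀ (G : Type) [Group G] [TopologicalSpace G] [IsTopologicalGroup G] [CompactSpace G], IsCompactSimpleLieGroup G → letI : MeasurableSpace G := borel G; haveI : BorelSpace G := ⟨rfl⟩; ∃ (r : LatticeRep G) (sch : SpeciesScheme (YMSpecies G)) (S : LabelledSchwingerFamily (YMSpecies G) (E)), sch.HasWeakCouplingLimit ∧ (∀ (n : ℕ), n ≠ 0 → ∀ (f : Fin n → SchwartzMap (E) ℝ) (F : SchwartzMap (Fin n → E) ℂ), IsTensorOf F (fun i => ofRealTest (f i)) → IsOffDiagonal F → Filter.Tendsto (fun k : ℕ => ((tiltedLatticeSchwinger r.ρ sch (fun s => s.F) k n (fun _ => r.curvature) f : ℝ) : ℂ)) Filter.atTop (nhds (S n (fun _ => r.curvature) F))) ∧ (S.IsNormalized ∧ S.IsHermitian ∧ S.HasLinearGrowth ∧ S.IsReflectionPositive ∧ S.IsSymmetric ∧ S.HasClusterProperty ∧ (∀ (n : ℕ) (k : Fin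 n → YMSpecies G) (a : E) (F : SchwartzMap (Fin n → E) ℂ), IsOffDiagonal F → S n k (translateMulti a F) = S n k F) ∧ (∀ (n : ℕ) (k : Fin n → YMSpecies G) (R : E ≃ₗᵢ[ℝ] E), LinearMap.det (R.toLinearEquiv : E →ₗ[ℝ] E) = 1 → (∀ i : Fin 4, ∃ j : Fin 4, R (EuclideanSpace.single i 1) = EuclideanSpace.single j 1 ∨ R (EuclideanSpace.single i 1) = -EuclideanSpace.single j 1) → ∀ F : SchwartzMap (Fin n → E) ℂ, IsOffDiagonal F → S n k (linActMulti R F) = S n k F)) ∧ (∀ (n : ℕ), n ≠ 0 → ∀ (σ : Fin n → YMSpecies G) (f : Fin n → SchwartzMap (E) ℝ) (F : SchwartzMap (Fin n → E) ℂ), IsTensorOf F (fun i => ofRealTest (f i)) → IsOffDiagonal F → Filter.Tendsto (fun k : ℕ => ((latticeSchwinger r.ρ sch (fun s => s.F) k n σ f : ℝ) : ℂ)) Filter.atTop (nhds (S n σ F))) ∧ (∃ (F₁ G₁ : SchwartzMap (Fin 1 → E) ℂ) (H₁ : SchwartzMap (Fin (1 + 1) → E) ℂ), IsTimeOrdered F₁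 ∧ IsTimeOrdered G₁ ∧ IsAppendTensorOf H₁ (osAdjoint F₁) G₁ ∧ S (1 + 1) (fun _ => r.curvature) H₁ ≠ S 1 (fun _ => r.curvature) (osAdjoint F₁) * S 1 (fun _ => r.curvature) G₁) ∧ (∃ (f g h : SchwartzMap (E) ℂ) (Ffgh : SchwartzMap (Fin 3 → E) ℂ) (Fgh Ffh Ffg : SchwartzMap (Fin 2 → E) ℂ) (Ff Fg Fh : SchwartzMap (Fin 1 → E) ℂ), IsTensorOf Ffgh ![f, g, h] ∧ IsOffDiagonal Ffgh ∧ IsTensorOf Fgh ![g, h] ∧ IsTensorOf Ffh ![f, h] ∧ IsTensorOf Ffg ![f, g] ∧ IsTensorOf Ff ![f] ∧ IsTensorOf Fg ![g] ∧ IsTensorOf Fh ![h] ∧ S 3 (fun _ => r.curvature) Ffgh - S 1 (fun _ => r.curvature) Ff * S 2 (fun _ => r.curvature) Fgh - S 1 (fun _ => r.curvature) Fg * S 2 (fun _ => r.curvature) Ffh - S 1 (fun _ => r.curvature) Fh * S 2 (fun _ => r.curvature) Ffg + 2 * (S 1 (fun _ => r.curvature) Ff * S 1 (fun _ => r.curvature)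 Fg * S 1 (fun _ => r.curvature) Fh) ≠ 0) ∧ (∃ Δ : ℝ, 0 < Δ ∧ S.HasMassGap Δ ∧ HasLatticeMassGap r sch Δ))
    (hE : EngineFromPowerCounting) (hC : PlanarSpectralCone) : YangMills :=
  closes_without_diag_mmb hK (hE hT hSig) hC hHC

end IsotropyFromPowerCounting

/-! ## §5 Registered sub-goal of the item (strategist r1): `PencilRigidity` closes from the weak-coupling slice alone -/

/-- **Registered sub-goal `stub_closesOfWeakCouplingSlice`** (crux-folder vocabulary): the route `PencilRigidity` is decided by
its other items and the WEAK-COUPLING SLICE of the crux — the kernel-checked form of "D is over-universal for the route". -/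
theorem stub_closesOfWeakCouplingSlice : Summit.QuantumFields.YangMills.Theses.PencilRigidity.ShellRigidity → Summit.QuantumFields.YangMills.Theses.PencilRigidity.NPointIsotropy → Summit.QuantumFields.YangMills.Theses.PencilRigidity.CurvatureKernelBound → (∀ (G : Type) [Group G] [TopologicalSpace G] [IsTopologicalGroup G] [CompactSpace G], IsCompactSimpleLieGroup G → letI : MeasurableSpace G := borel G; haveI : BorelSpace G := ⟨rfl⟩; ∀ (r : LatticeRep G) (sch : SpeciesScheme (YMSpecies G)) (S₁ : SchwingerFamily E4), CurvaturePackage r sch S₁ → sch.HasWeakCouplingLimit → DiagonalFrameRP S₁) → Summit.QuantumFields.YangMills.Theses.PencilRigidity.WeakCouplingHypercubicLimit → Summit.QuantumFields.YangMills.Theses.PencilRigidity.CurvatureChannel → Summit.QuantumFields.YangMills.Theses.PencilRigidity.KernelTransfer → Summit.QuantumFields.YangMills.Theses.PencilRigidity.PlanarToEuclidean → YangMills :=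
  fun hSR hNP hKB hSlice hWHL hCC hKT hPE => closes_of_slice hSR hNP hKB hSlice hWHL hCC hKT hPE

end Summit.QuantumFields.YangMills.Cruxes.DiagonalMirrorRPR.Eliminable

end
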